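import Mathlib
import Summits.PneNP.PneNP.Theorems.SfmBlSpotBudget

/-!
# Spot budget for `ℓ` legs per output — line «sfm-bl» made parametric (cell pnp-ideate, ROUND-18 item K1''
# `SignDeg2Signing.SignDeg2SigningFP`, stage S2)

FRONTIER (range avoidance for sign-degree-≤2 local maps at linear stretch; restricted-model algorithmic
rung); nothing here bears on P vs NP.

The landed spot budget `SfmBlSpotBudget` (Lemma 10 of PROOF-SFM-BL) is stated for `≤ 3` legs per output
(pure CAND).  The sign-degree-2 engine runs the same first-moment accounting on the certificate leg system
of `SignDeg2SigningLegs` with `ℓ = 2W` unit legs per output.  This file re-derives the three leg-count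
statements with a free `ℓ`:

* `sum_legCount_sq_le_ell` — `Σ_j c_j² ≤ ℓ·e(W₁, W₂)` (variance proxy of a pair discrepancy);
* `card_badSignings_pair_le_ell` — `#{T : γ√(|W₁||W₂|) < |disc_T|} ≤ 2·2^m·exp(−γ′²(|W₁|+|W₂|)/(12L))`
  for any auxiliary `γ′` with `γ′²·ℓ ≤ 3γ²` (so that with the bad threshold `γ = γ′·√(ℓ/3)` the exponent has
  EXACTLY the landed shape and the numerical series `SfmBl.hatE_weight_sum_le` applies verbatim);
* `sum_hatE_le_ell` — Lemma 10 (exchange of sums) in the same shape.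

Proofs: the landed analytic core `SfmBl.card_abs_signSum_gt_le_of_sq_le` at the rescaled degree `ℓL/3`.
-/

set_option linter.dupNamespace false -- `Summit.PneNP.PneNP.…`: summit = sub-problem name (D-0017 single-conjunct layout)

namespace Summit.PneNP.PneNP.Theorems.Sd2Bl

open Matrix Finset BigOperators
open Summit.PneNP.PneNP.Theorems.CandCutNorm Summit.PneNP.PneNP.Theorems.SfmBl

variable {α β E : Type*} [Fintype α] [Fintype β] [Fintype E] [DecidableEq α] [DecidableEq β]

omit [Fintype α] [Fintype β] in
/-- LEMMA 4 SET-UP for `ℓ` legs per output: `Σ_j c_j² ≤ ℓ·e(W₁, W₂)` where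
`c_j = #{legs of output j from W₁ to W₂}`. -/
theorem sum_legCount_sq_le_ell {m : ℕ} (src : E → α) (dst : E → β) (out : E → Fin m) {ℓ : ℕ}
    (hout : ∀ j : Fin m, (Finset.univ.filter (fun e => out e = j)).card ≤ ℓ)
    (W₁ : Finset α) (W₂ : Finset β) :
    ∑ j : Fin m, ((Finset.univ.filter (fun e => out e = j ∧ src e ∈ W₁ ∧ dst e ∈ W₂)).card : ℝ) ^ 2
      ≤ ℓ * ((Finset.univ.filter (fun e => src e ∈ W₁ ∧ dst e ∈ W₂)).card : ℝ) := by
  classical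
  have hc : ∀ j : Fin m, (Finset.univ.filter (fun e => out e = j ∧ src e ∈ W₁ ∧ dst e ∈ W₂)).card ≤ ℓ := by
    intro j
    refine le_trans (Finset.card_le_card ?_) (hout j)
    intro e; simp only [Finset.mem_filter, Finset.mem_univ, true_and]; exact fun h => h.1
  calc ∑ j : Fin m, ((Finset.univ.filter (fun e => out e = j ∧ src e ∈ W₁ ∧ dst e ∈ W₂)).card : ℝ) ^ 2
      ≤ ∑ j : Fin m, (ℓ : ℝ) * ((Finset.univ.filter (fun e => out e = j ∧ src e ∈ W₁ ∧ dst e ∈ W₂)).card : ℝ) := by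
        refine Finset.sum_le_sum fun j _ => ?_
        have h3 : ((Finset.univ.filter (fun e => out e = j ∧ src e ∈ W₁ ∧ dst e ∈ W₂)).card : ℝ) ≤ ℓ := by
          exact_mod_cast hc j
        have h0 : (0 : ℝ) ≤ ((Finset.univ.filter (fun e => out e = j ∧ src e ∈ W₁ ∧ dst e ∈ W₂)).card : ℝ) :=
          by positivity
        nlinarith
    _ = ℓ * ((Finset.univ.filter (fun e => src e ∈ W₁ ∧ dst e ∈ W₂)).card : ℝ) := by
        rw [← Finset.mul_sum, ← sum_legCount_eq_card src dst out W₁ W₂]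
        push_cast; rfl

/-- BAD SIGNINGS OF ONE PAIR, `ℓ` legs per output.  Output-shared signs, leg-degrees `≤ L` (`0 < L`),
threshold `γ ≥ 0`, and an auxiliary `γ′` with `γ′²·ℓ ≤ 3γ²`:
`#{T : γ√(|W₁||W₂|) < |disc_T(W₁, W₂)|} ≤ 2·2^m·exp(−γ′²(|W₁|+|W₂|)/(12L))`. -/
theorem card_badSignings_pair_le_ell {m : ℕ} (src : E → α) (dst : E → β) (out : E → Fin m)
    (M : (Fin m → Bool) → Matrix α β ℝ)
    (hM : ∀ T i k, M T i k = ∑ e ∈ Finset.univ.filter (fun e => src e = i ∧ dst e = k),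
      ((boolSign (T (out e)) : ℤ) : ℝ))
    {ℓ : ℕ} (hℓ : 0 < ℓ) (hout : ∀ j : Fin m, (Finset.univ.filter fun e => out e = j).card ≤ ℓ)
    {L : ℕ} (hL : 0 < L) (hdeg₁ : ∀ i, (Finset.univ.filter fun e => src e = i).card ≤ L)
    (hdeg₂ : ∀ k, (Finset.univ.filter fun e => dst e = k).card ≤ L) {γ γ' : ℝ} (hγ : 0 ≤ γ)
    (hγγ' : γ' ^ 2 * ℓ ≤ 3 * γ ^ 2)
    (W₁ : Finset α) (W₂ : Finset β) :
    ((Finset.univ.filter fun T : Fin m → Bool =>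
        γ * Real.sqrt ((W₁.card : ℝ) * (W₂.card : ℝ)) < |∑ i ∈ W₁, ∑ k ∈ W₂, M T i k|).card : ℝ)
      ≤ 2 * (2 ^ m * Real.exp (-(γ' ^ 2 * ((W₁.card : ℝ) + W₂.card) / (12 * L)))) := by
  classical
  -- rewrite the discrepancy as the signed sum of the leg counts
  have hdisc : ∀ T : Fin m → Bool, ∑ i ∈ W₁, ∑ k ∈ W₂, M T i k
      = ∑ j, ((Finset.univ.filter fun e => out e = j ∧ src e ∈ W₁ ∧ dst e ∈ W₂).card : ℝ)
          * ((boolSign (T j) : ℤ) : ℝ) := fun T =>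
    pairSum_eq_sum_outputs src dst out T (M T) (hM T) W₁ W₂
  have hfilt : (Finset.univ.filter fun T : Fin m → Bool =>
        γ * Real.sqrt ((W₁.card : ℝ) * (W₂.card : ℝ)) < |∑ i ∈ W₁, ∑ k ∈ W₂, M T i k|)
      = (Finset.univ.filter fun T : Fin m → Bool =>
        γ * Real.sqrt ((W₁.card : ℝ) * (W₂.card : ℝ))
          < |∑ j, ((Finset.univ.filter fun e => out e = j ∧ src e ∈ W₁ ∧ dst e ∈ W₂).card : ℝ)
              * ((boolSign (T j) : ℤ) : ℝ)|) :=
    Finset.filter_congr fun T _ => by rw [hdisc T]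
  rw [hfilt]
  -- the two variance bounds `Σc² ≤ ℓ·e(W₁,W₂) ≤ ℓL|W₁| = 3·((ℓL/3)·|W₁|)`, and the same with `|W₂|`
  have hSle := sum_legCount_sq_le_ell src dst out hout W₁ W₂
  have he1 : ((Finset.univ.filter fun e => src e ∈ W₁ ∧ dst e ∈ W₂).card : ℝ) ≤ L * (W₁.card : ℝ) := by
    exact_mod_cast card_pair_le_mul_card_left src dst hdeg₁ W₁ W₂
  have he2 : ((Finset.univ.filter fun e => src e ∈ W₁ ∧ dst e ∈ W₂).card : ℝ) ≤ L * (W₂.card : ℝ) := by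
    exact_mod_cast card_pair_le_mul_card_right src dst hdeg₂ W₁ W₂
  have hL' : (0 : ℝ) < L := by exact_mod_cast hL
  have hℓ' : (0 : ℝ) < ℓ := by exact_mod_cast hℓ
  have hLℓ : (0 : ℝ) < ℓ * L / 3 := by positivity
  have h1 : ∑ j : Fin m, ((Finset.univ.filter fun e => out e = j ∧ src e ∈ W₁ ∧ dst e ∈ W₂).card : ℝ) ^ 2
      ≤ 3 * ((ℓ * L / 3) * (W₁.card : ℝ)) := by
    have := mul_le_mul_of_nonneg_left he1 hℓ'.le
    calc _ ≤ (ℓ : ℝ) * ((Finset.univ.filter fun e => src e ∈ W₁ ∧ dst e ∈ W₂).card : ℝ) := hSle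
      _ ≤ ℓ * (L * (W₁.card : ℝ)) := this
      _ = 3 * ((ℓ * L / 3) * (W₁.card : ℝ)) := by ring
  have h2 : ∑ j : Fin m, ((Finset.univ.filter fun e => out e = j ∧ src e ∈ W₁ ∧ dst e ∈ W₂).card : ℝ) ^ 2
      ≤ 3 * ((ℓ * L / 3) * (W₂.card : ℝ)) := by
    have := mul_le_mul_of_nonneg_left he2 hℓ'.le
    calc _ ≤ (ℓ : ℝ) * ((Finset.univ.filter fun e => src e ∈ W₁ ∧ dst e ∈ W₂).card : ℝ) := hSle
      _ ≤ ℓ * (L * (W₂.card : ℝ)) := this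
      _ = 3 * ((ℓ * L / 3) * (W₂.card : ℝ)) := by ring
  have hmain := card_abs_signSum_gt_le_of_sq_le _ (Nat.cast_nonneg _) (Nat.cast_nonneg _) hLℓ hγ h1 h2
  refine hmain.trans ?_
  -- compare the exponents: `γ′²(a+b)/(12L) ≤ γ²(a+b)/(12·(ℓL/3))`
  have hab : (0 : ℝ) ≤ (W₁.card : ℝ) + W₂.card := by positivity
  have hexp : Real.exp (-(γ ^ 2 * ((W₁.card : ℝ) + W₂.card) / (12 * (ℓ * L / 3))))
      ≤ Real.exp (-(γ' ^ 2 * ((W₁.card : ℝ) + W₂.card) / (12 * L))) := by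
    rw [Real.exp_le_exp, neg_le_neg_iff]
    rw [div_le_div_iff₀ (by positivity) (by positivity)]
    have h3 := mul_le_mul_of_nonneg_right hγγ' hab
    have h4 : (0 : ℝ) ≤ 4 * L := by positivity
    calc γ' ^ 2 * ((W₁.card : ℝ) + W₂.card) * (12 * (ℓ * L / 3))
        = (γ' ^ 2 * ℓ * ((W₁.card : ℝ) + W₂.card)) * (4 * L) := by ring
      _ ≤ (3 * γ ^ 2 * ((W₁.card : ℝ) + W₂.card)) * (4 * L) := mul_le_mul_of_nonneg_right h3 h4
      _ = γ ^ 2 * ((W₁.card : ℝ) + W₂.card) * (12 * L) := by ring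
  have h2m : (0 : ℝ) ≤ 2 ^ m := by positivity
  exact mul_le_mul_of_nonneg_left (mul_le_mul_of_nonneg_left hexp h2m) (by norm_num)

/-- LEMMA 10 (first moment of `ê`), `ℓ` legs per output, in the landed shape:
`Σ_T ê(T) ≤ 2·2^m · Σ_{W ∈ 𝒲} #{legs meeting W}·e^{−γ′²(|W₁|+|W₂|)/(12L)}` whenever `bad T ⊆ 𝒲`, membership in
`bad T` implies `γ√(|W₁||W₂|) < |disc_T|`, and `γ′²·ℓ ≤ 3γ²`. -/
theorem sum_hatE_le_ell {m : ℕ} (src : E → α) (dst : E → β) (out : E → Fin m)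
    (M : (Fin m → Bool) → Matrix α β ℝ)
    (hM : ∀ T i k, M T i k = ∑ e ∈ Finset.univ.filter (fun e => src e = i ∧ dst e = k),
      ((boolSign (T (out e)) : ℤ) : ℝ))
    {ℓ : ℕ} (hℓ : 0 < ℓ) (hout : ∀ j : Fin m, (Finset.univ.filter fun e => out e = j).card ≤ ℓ)
    {L : ℕ} (hL : 0 < L) (hdeg₁ : ∀ i, (Finset.univ.filter fun e => src e = i).card ≤ L)
    (hdeg₂ : ∀ k, (Finset.univ.filter fun e => dst e = k).card ≤ L) {γ γ' : ℝ} (hγ : 0 ≤ γ)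
    (hγγ' : γ' ^ 2 * ℓ ≤ 3 * γ ^ 2)
    (bad : (Fin m → Bool) → Finset (Finset α × Finset β)) (𝒲 : Finset (Finset α × Finset β))
    (hsub : ∀ T, bad T ⊆ 𝒲)
    (hbad : ∀ T W, W ∈ bad T →
      γ * Real.sqrt ((W.1.card : ℝ) * (W.2.card : ℝ)) < |∑ i ∈ W.1, ∑ k ∈ W.2, M T i k|) :
    ∑ T : Fin m → Bool, ∑ W ∈ bad T, ((Finset.univ.filter fun e => src e ∈ W.1 ∨ dst e ∈ W.2).card : ℝ)
      ≤ 2 * 2 ^ m * ∑ W ∈ 𝒲, ((Finset.univ.filter fun e => src e ∈ W.1 ∨ dst e ∈ W.2).card : ℝ)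
          * Real.exp (-(γ' ^ 2 * ((W.1.card : ℝ) + W.2.card) / (12 * L))) := by
  classical
  have h1 : ∀ T, ∑ W ∈ bad T, ((Finset.univ.filter fun e => src e ∈ W.1 ∨ dst e ∈ W.2).card : ℝ)
      = ∑ W ∈ 𝒲, (if W ∈ bad T then
          ((Finset.univ.filter fun e => src e ∈ W.1 ∨ dst e ∈ W.2).card : ℝ) else 0) := by
    intro T
    rw [← Finset.sum_filter]
    congr 1
    ext W; simp only [Finset.mem_filter]
    exact ⟨fun h => ⟨hsub T h, h⟩, fun h => h.2⟩
  simp_rw [h1]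
  rw [Finset.sum_comm, Finset.mul_sum]
  refine Finset.sum_le_sum fun W _ => ?_
  have hmeet0 : (0 : ℝ) ≤ ((Finset.univ.filter fun e => src e ∈ W.1 ∨ dst e ∈ W.2).card : ℝ) := by
    positivity
  have h2 : ∑ T : Fin m → Bool, (if W ∈ bad T then
        ((Finset.univ.filter fun e => src e ∈ W.1 ∨ dst e ∈ W.2).card : ℝ) else 0)
      = ((Finset.univ.filter fun e => src e ∈ W.1 ∨ dst e ∈ W.2).card : ℝ)
          * ((Finset.univ.filter fun T : Fin m → Bool => W ∈ bad T).card : ℝ) := by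
    rw [← Finset.sum_filter, Finset.sum_const, nsmul_eq_mul, mul_comm]
  rw [h2]
  have hsubT : (Finset.univ.filter fun T : Fin m → Bool => W ∈ bad T)
      ⊆ (Finset.univ.filter fun T : Fin m → Bool =>
          γ * Real.sqrt ((W.1.card : ℝ) * (W.2.card : ℝ)) < |∑ i ∈ W.1, ∑ k ∈ W.2, M T i k|) := by
    intro T hT
    simp only [Finset.mem_filter, Finset.mem_univ, true_and] at hT ⊢
    exact hbad T W hT
  have h3 : ((Finset.univ.filter fun T : Fin m → Bool => W ∈ bad T).card : ℝ)
      ≤ ((Finset.univ.filter fun T : Fin m → Bool =>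
          γ * Real.sqrt ((W.1.card : ℝ) * (W.2.card : ℝ)) < |∑ i ∈ W.1, ∑ k ∈ W.2, M T i k|).card : ℝ) :=
    Nat.cast_le.2 (Finset.card_le_card hsubT)
  have h4 := card_badSignings_pair_le_ell src dst out M hM hℓ hout hL hdeg₁ hdeg₂ hγ hγγ' W.1 W.2
  calc ((Finset.univ.filter fun e => src e ∈ W.1 ∨ dst e ∈ W.2).card : ℝ)
        * ((Finset.univ.filter fun T : Fin m → Bool => W ∈ bad T).card : ℝ)
      ≤ ((Finset.univ.filter fun e => src e ∈ W.1 ∨ dst e ∈ W.2).card : ℝ)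
        * (2 * (2 ^ m * Real.exp (-(γ' ^ 2 * ((W.1.card : ℝ) + W.2.card) / (12 * L))))) :=
        mul_le_mul_of_nonneg_left (h3.trans h4) hmeet0
    _ = 2 * 2 ^ m * (((Finset.univ.filter fun e => src e ∈ W.1 ∨ dst e ∈ W.2).card : ℝ)
        * Real.exp (-(γ' ^ 2 * ((W.1.card : ℝ) + W.2.card) / (12 * L)))) := by ring

end Summit.PneNP.PneNP.Theorems.Sd2Bl
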